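import Summits.BirchSwinnertonDyer.Rank1Residual.X12.CMNoPrimeTorsion
import Literature.NumberTheory.EllipticCurves.LawsonWuthrich2016.ShaIndexBoundReducibleGeneral
import Literature.NumberTheory.EllipticCurves.Rank1Residual.Typed.KolyvaginCertificate
import Literature.NumberTheory.EllipticCurves.HeegnerHypothesisKroneckerProofs
import HarnessLib

/-!
# X12: the PER-PAIR route through Lawson–Wuthrich 2016 Thm. 14 (T-LW) at `p ≥ 7` (incl. `11`) —
# booking shapes with the torsion clause, the `p = 11` item and `p ∤ d_{K′}` DISCHARGED;
# STATUS (referee-2 ruling R2-33.2, 2026-08-20): CONDITIONAL theorems; T-LW's reducible-`E[p]` case is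
# CONTESTED in print (Matar–Nekovář 2019 §0.10–0.11), so at the 15 RAMIFIED pairs a closure through
# these shapes is FLAGGED `LW16-Thm14-disputed-MN19-0.11`, NOT PUB (see "Status of the lever" below)

HONEST FRAMING (cell `b2b-bsdres`, run/shared/lean/b2b/bsd-rank1-residual/, verbatim in every
file): the goal of the cell is to DELETE the COMBINATION-SHAPED residual classes of the
Birch–Swinnerton-Dyer formula for ALL analytic-rank `≤ 1` elliptic curves over `ℚ` — "full BSD
formula for every rank `≤ 1` curve in class `C`" assembled STRICTLY from published theorems — so
that the rank-`≤ 1` remainder becomes exactly the CONSTRUCTION-SHAPED classes, which are TYPED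
(missing-input `Prop`s), NOT attempted. This is not "finishing BSD". Harvest seat 1 (census /
instrument seat for class X12; prover owner x1b since 2026-08-20T04:23Z), generation 17. Theorems
only (compositions of tree theorems BY NAME); no definition, no named fact; PER PAIR, not a class
theorem; NOTHING booked (the lane books, under the referee's conditions); no label and no census
number moves; X12 REMAINS CONSTRUCTION-SHAPED.

## What this file records

Class X12 (`Rank1Residual.ClassX12`: CM, analytic rank one, `p ∣ 6·d_K·N`). At `p ≥ 5` an X12
pair is ADDITIVE at `p` (gen 16 `addv_of_classX12_of_five_le`) and either `p` is INERT in the CM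
field (the 72-pair inert-bad core of the census; `E[p]` irreducible, per-pair lever T-MN19 =
Matar–Nekovář 2019 Thm. 6.7 (1), `X12/HeegnerIndexRoute.lean`, `X12/CMIrreducible.lean`) or `p`
is RAMIFIED in it (15 census pairs `N < 2·10⁴`: `7 × (j = −3375, p = 7)`, `4 × (−32768, 11)`,
`2 × (−884736, 19)`, `(−884736000, 43)`, `(−147197952000, 67)`; `E[p]` REDUCIBLE,
`X12/CMRamifiedReducible.lean`, so neither Kolyvagin–Cha nor Matar–Nekovář applies). The X12 owner's
route memo (`HOME/b2b-bsdres-x1b/X12-ROUTE.md` §1) names the ramified pairs' only per-pair lever: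
**T-LW = Lawson–Wuthrich 2016 Thm. 14** — Kolyvagin's Heegner-index bound
`ord_p #Ш(E/ℚ) ≤ 2·ord_p [E(K′) : ℤ y_{K′}]` WITHOUT an image hypothesis at `p` (tree fact
`LawsonWuthrich2016.thm14_padicValNat_shaOrder_le`, x1a gen 9, vendored at `p ≥ 7, p ≠ 11`; the
`p = 11` extension with Theorem 1's item "E is 121c2" as printed is the sibling fact
`thm14_padicValNat_shaOrder_le_general`, harvest-1 gen 17, p206606; §3 below). Its side
conditions at a CM pair are THEOREMS:

* the torsion clause `htors` ("no curve `ℚ`-isogenous to `E` has a rational point of order `p`") —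
  `X12.noPTorsion_isogenyClass_of_classX12` (`X12/CMNoPrimeTorsion.lean`: CM ∧ `p ≥ 5`);
* `p ∤ d_{K′}` for the Heegner field `K′` — every prime of `N` splits in `K′`, and `p ∣ N` since the
  pair is additive at `p`; in the tree's shape the level `N` of the Heegner datum is a free
  parameter, so this is offered both as a binder `hpD` and discharged from `p ∣ N`
  (`Literature.SatisfiesHeegnerHypothesis.not_dvd_discr`);
* Theorem 1's item at `p = 11` (for the `_general` fact): a CM `j` is never `j(121c2) = −24729001`
  (`X12.j_ne_j121c2_of_hasCM`) — §3, the shapes at every `p ≥ 7`, `p = 11` INCLUDED.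

So the booking shape `bsdp_of_lawsonWuthrich_of_not_dvd_index` takes exactly: the two PUBLISHED
named facts (`hLW`, `hGZK`), the class, `7 ≤ p ≠ 11`, a Heegner field `K′` for a level `N` with
`p ∣ N`, a Heegner point `y_{K′}` of infinite order with `p ∤ [E(K′) : ℤ y_{K′}]` (the lane's
two-implementation index certificate), and `#Ш_an = q` with `ord_p q = 0`. On the census this is the
shape of all 15 ramified pairs (the four at `p = 11` through §3's general fact; there `E[p]` is
REDUCIBLE and the lever is CONTESTED — FLAGGED, NOT PUB, see "Status of the lever") AND — as a
second lever besides T-MN19 — of all 72 inert-bad core pairs. PER PAIR; nothing booked here.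

## Status of the lever (added after referee-2 ruling R2-33.2, 2026-08-20T06:00Z; X12 owner memo
## `HOME/b2b-bsdres-x1b/gen9/LW14-CAVEAT.md`)

A. Matar, J. Nekovář, J. Théor. Nombres Bordeaux **31** (2019) 455–501, p. 457 (held
`paper:doi-10-5802-jtnb-1091`, read by the harvest seat), §0.11: "the claims made in [19, Thm. 14]
(= Lawson–Wuthrich Thm. 14) about the validity of Theorem 0.3 (= Kolyvagin's index bound) in
situations when (a) holds but `ρ̄_{E,p}` is reducible are unjustified, for reasons explained in
Section 0.10" (§0.10: "the current state of the art requires an irreducibility assumption for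
`ρ̄_{E,p}` […] in order to obtain, by Kolyvagin's method, an upper bound on the size of
`Ш(E/K)[p^∞]` without any error terms. As a result, [11, Thm. 3.7] (= GJPST) remains unproved");
the irreducible case is re-proved ibid.; no reply by Lawson–Wuthrich located (2026-08-20; full
quotation and search record in the module docstring of
`Literature/…/LawsonWuthrich2016/ShaIndexBoundReducibleGeneral.lean`, § Dispute in print).
CONSEQUENCES, per the ruling: (a) every theorem of this file STANDS as stated — each takes the named
fact `hLW` as a HYPOTHESIS and asserts nothing about its truth (conditional theorems, admissible);
(b) at pairs with `E[p]` REDUCIBLE — ALL 15 ramified X12 pairs, i.e. every instance of these shapes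
with `p ∣ d_K` (in particular the four `p = 11` pairs of §3) — a closure through them is FLAGGED
`LW16-Thm14-disputed-MN19-0.11`, NOT PUB, and the pair stays in its pre-T-LW bucket (the three
resistant ramified pairs `1849a1 @ 43`, `9025a1 @ 19`, `4489a1 @ 67` remain RESISTANT; the twelve
ramified pairs closed by sha-2's `p`-isogeny descents do not use T-LW and are unaffected); (c) at
the 72 inert-bad core pairs (`E[p]` IRREDUCIBLE, `X12/CMIrreducible.lean`) the undisputed levers are
the Matar–Nekovář facts, which the ruling (item (3)) prefers there: T-MN19
(`X12/HeegnerIndexRoute.lean`, fact `MatarNekovar2019.thm67_sha_primary_trivial_of_irreducible`)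
and the X12 owner's class-level upper half through
`MatarNekovar2019.thm03_padicValNat_card_sha_le_of_irreducible`; at such pairs Thm. 14's claim is
its undisputed case, so the shapes below carry no dispute flag there — they are merely redundant.

References: Lawson–Wuthrich 2016 §5 Thm. 14, Thm. 1; GJPST 2009 Thm. 3.7 (journal numbering; "3.5"
in Lawson–Wuthrich's citation); Miller 2011 Def. 1.1, §4; Gross 1991 §1 (Heegner hypothesis);
Matar–Nekovář 2019 §0.10–0.11 (the dissent).
-/

noncomputable section

open scoped Classical

open WeierstrassCurve Literature.NumberTheory.EllipticCurves
  Literature.NumberTheory.EllipticCurves.Rank1Residual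
  Literature.NumberTheory.EllipticCurves.Rank1Residual.Typed
  Literature.NumberTheory.EllipticCurves.LawsonWuthrich2016

namespace Summit.BirchSwinnertonDyer.Rank1Residual.X12

variable (W : WeierstrassCurve ℚ) [W.IsElliptic] [W.IsGloballyMinimal] (p : ℕ) [hp : Fact p.Prime]

/-! ## §1 `Ш(E/ℚ)[p] = 0` and `BSD(E,p)` from the T-LW index certificate, CM form (`p ≥ 7`, `p ≠ 11`) -/

/-- **`ord_p #Ш(E/ℚ) = 0` for a CM curve of analytic rank `≤ 1` from the Lawson–Wuthrich index
certificate** (`p ≥ 7`, `p ≠ 11`; ANY splitting type of `p` in the CM field, reducible `E[p]`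
allowed): inputs the PUBLISHED fact `hLW` (Lawson–Wuthrich 2016 Thm. 14), a Heegner field `K′`
(imaginary quadratic, Heegner hypothesis for the level `N`) with `p ∤ d_{K′}`, a Heegner point
`P = y_{K′}` of level `N` of infinite order with `p ∤ [E(K′) : ℤ P]`. The torsion clause of the fact
is DISCHARGED (`noPTorsion_isogenyClass_of_hasCM`). [cite: LawsonWuthrich2016, §5 Thm. 14 (arXiv:1505.02940 p. 8)]
[cite: Miller2011LMS, §4 (y_K, I_K)] -/
theorem padicValNat_shaOrder_eq_zero_of_lawsonWuthrich_of_hasCM (hLW : thm14_padicValNat_shaOrder_le)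
    (hCM : W.HasCM) (hr : W.analyticRank ≤ 1) (hp7 : 7 ≤ p) (hp11 : p ≠ 11)
    {N : ℕ} [NeZero N] {K' : Type} [Field K'] [NumberField K'] (hK' : IsImaginaryQuadratic K')
    (hH : SatisfiesHeegnerHypothesis N K') {P : (W.baseChange K').toAffine.Point}
    (hP : IsHeegnerPoint N W K' P) (hnt : ¬ IsOfFinAddOrder P)
    (hpD : ¬ (p : ℤ) ∣ NumberField.discr K') (hI : ¬ p ∣ (AddSubgroup.zmultiples P).index) :
    padicValNat p W.shaOrder = 0 :=
  LawsonWuthrich2016.padicValNat_shaOrder_eq_zero_of_not_dvd_index hLW W hK' hH hP hnt p hp7 hp11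
    hpD (noPTorsion_isogenyClass_of_hasCM W hCM (by omega)) hr hI

/-- **`Ш(E/ℚ)[p] = 0` at an X12 pair from the T-LW index certificate** (`p ≥ 7`, `p ≠ 11`; inert
OR ramified `p`): `ord_p #Ш = 0` by the previous theorem and `Ш` finite by GZK (`hGZK`).
[cite: LawsonWuthrich2016, §5 Thm. 14 (arXiv:1505.02940 p. 8)] [cite: Miller2011LMS, §4 (y_K, I_K)] -/
theorem noPTorsionSha_of_lawsonWuthrich_of_not_dvd_index (hLW : thm14_padicValNat_shaOrder_le)
    (hGZK : rank_eq_analyticRank_of_analyticRank_le_one) (hX : ClassX12 W p) (hp7 : 7 ≤ p)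
    (hp11 : p ≠ 11) {N : ℕ} [NeZero N] {K' : Type} [Field K'] [NumberField K']
    (hK' : IsImaginaryQuadratic K') (hH : SatisfiesHeegnerHypothesis N K')
    {P : (W.baseChange K').toAffine.Point} (hP : IsHeegnerPoint N W K' P) (hnt : ¬ IsOfFinAddOrder P)
    (hpD : ¬ (p : ℤ) ∣ NumberField.discr K') (hI : ¬ p ∣ (AddSubgroup.zmultiples P).index) :
    ∀ x : W.sha, (p : ℤ) • x = 0 → x = 0 :=
  noPTorsion_of_padicValNat_shaOrder_eq_zero W p (hGZK W hX.2.1.le).2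
    (padicValNat_shaOrder_eq_zero_of_lawsonWuthrich_of_hasCM W p hLW hX.1 hX.2.1.le hp7 hp11 hK' hH
      hP hnt hpD hI)

/-- **THE BOOKING SHAPE (T-LW at an X12 pair, `p ≥ 7`, `p ≠ 11`).** Inputs: the PUBLISHED facts
`hLW` (Lawson–Wuthrich 2016 Thm. 14) and `hGZK` (Gross–Zagier–Kolyvagin); `ClassX12 W p`; a Heegner
field `K′` with the Heegner hypothesis for a level `N` and `p ∤ d_{K′}`; a Heegner point `y_{K′}`
of infinite order with `p ∤ [E(K′) : ℤ y_{K′}]`; `#Ш(E/ℚ)_an = q` with `ord_p q = 0`. Then Miller's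
`BSD(E, p)`. The torsion clause of Thm. 14 is a THEOREM here (`X12/CMNoPrimeTorsion.lean`); Theorem
1's list is empty at these `p`. Reducible `E[p]` allowed — so this is the lever for the RAMIFIED X12
pairs at `p ∈ {7, 19, 43, 67}` and a second lever on the inert-bad core. PER PAIR; nothing booked.
[cite: LawsonWuthrich2016, §5 Thm. 14 (arXiv:1505.02940 p. 8)] [cite: Miller2011LMS, §1 and Def. 1.1] -/
theorem bsdp_of_lawsonWuthrich_of_not_dvd_index (hLW : thm14_padicValNat_shaOrder_le)
    (hGZK : rank_eq_analyticRank_of_analyticRank_le_one) (hX : ClassX12 W p) (hp7 : 7 ≤ p)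
    (hp11 : p ≠ 11) {N : ℕ} [NeZero N] {K' : Type} [Field K'] [NumberField K']
    (hK' : IsImaginaryQuadratic K') (hH : SatisfiesHeegnerHypothesis N K')
    {P : (W.baseChange K').toAffine.Point} (hP : IsHeegnerPoint N W K' P) (hnt : ¬ IsOfFinAddOrder P)
    (hpD : ¬ (p : ℤ) ∣ NumberField.discr K') (hI : ¬ p ∣ (AddSubgroup.zmultiples P).index)
    {q : ℚ} (hq : shaAn W = (q : ℂ)) (hv : padicValRat p q = 0) : BSDp W p :=
  bsdp_of_shaAn_unit_of_noPTorsion W p hGZK hX.2.1.le hq hv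
    (noPTorsionSha_of_lawsonWuthrich_of_not_dvd_index W p hLW hGZK hX hp7 hp11 hK' hH hP hnt hpD hI)

/-- **The booking shape with `p ∤ d_{K′}` DISCHARGED from `p ∣ N`**: every prime of the level `N`
splits in the Heegner field (`Literature.SatisfiesHeegnerHypothesis.not_dvd_discr`), and at an X12
pair with `p ≥ 5` the prime `p` divides the conductor (additive reduction,
`not_good_of_classX12_of_five_le`) — so with `N` the conductor the binder `hpN` is automatic.
[cite: LawsonWuthrich2016, §5 Thm. 14 (arXiv:1505.02940 p. 8)] [cite: GrossLMS1991, §1 (p. 235)] [cite: Miller2011LMS, §1 and Def. 1.1] -/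
theorem bsdp_of_lawsonWuthrich_of_not_dvd_index_of_dvd_level (hLW : thm14_padicValNat_shaOrder_le)
    (hGZK : rank_eq_analyticRank_of_analyticRank_le_one) (hX : ClassX12 W p) (hp7 : 7 ≤ p)
    (hp11 : p ≠ 11) {N : ℕ} [NeZero N] {K' : Type} [Field K'] [NumberField K']
    (hK' : IsImaginaryQuadratic K') (hH : SatisfiesHeegnerHypothesis N K') (hpN : p ∣ N)
    {P : (W.baseChange K').toAffine.Point} (hP : IsHeegnerPoint N W K' P) (hnt : ¬ IsOfFinAddOrder P)
    (hI : ¬ p ∣ (AddSubgroup.zmultiples P).index)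
    {q : ℚ} (hq : shaAn W = (q : ℂ)) (hv : padicValRat p q = 0) : BSDp W p :=
  bsdp_of_lawsonWuthrich_of_not_dvd_index W p hLW hGZK hX hp7 hp11 hK' hH hP hnt
    (Literature.SatisfiesHeegnerHypothesis.not_dvd_discr hK'.1 hH hp.out hpN) hI hq hv

/-- The same with the CM / rank hypotheses spelled out instead of `ClassX12` (any `W` with CM of
analytic rank `≤ 1`, `p ≥ 7`, `p ≠ 11`). [cite: LawsonWuthrich2016, §5 Thm. 14 (arXiv:1505.02940 p. 8)]
[cite: Miller2011LMS, §1 and Def. 1.1] -/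
theorem bsdp_of_lawsonWuthrich_of_hasCM_of_not_dvd_index (hLW : thm14_padicValNat_shaOrder_le)
    (hGZK : rank_eq_analyticRank_of_analyticRank_le_one) (hCM : W.HasCM) (hr : W.analyticRank ≤ 1)
    (hp7 : 7 ≤ p) (hp11 : p ≠ 11) {N : ℕ} [NeZero N] {K' : Type} [Field K'] [NumberField K']
    (hK' : IsImaginaryQuadratic K') (hH : SatisfiesHeegnerHypothesis N K')
    {P : (W.baseChange K').toAffine.Point} (hP : IsHeegnerPoint N W K' P) (hnt : ¬ IsOfFinAddOrder P)
    (hpD : ¬ (p : ℤ) ∣ NumberField.discr K') (hI : ¬ p ∣ (AddSubgroup.zmultiples P).index)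
    {q : ℚ} (hq : shaAn W = (q : ℂ)) (hv : padicValRat p q = 0) : BSDp W p :=
  bsdp_of_shaAn_unit_of_noPTorsion W p hGZK hr hq hv
    (noPTorsion_of_padicValNat_shaOrder_eq_zero W p (hGZK W hr).2
      (padicValNat_shaOrder_eq_zero_of_lawsonWuthrich_of_hasCM W p hLW hCM hr hp7 hp11 hK' hH hP hnt
        hpD hI))

/-- … and the typed residue of X12 (`Typed.X12.MissingInputAt W p`) follows at such a pair.
[cite: LawsonWuthrich2016, §5 Thm. 14 (arXiv:1505.02940 p. 8)] [cite: Miller2011LMS, Def. 1.1] -/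
theorem missingInputAt_of_lawsonWuthrich_of_not_dvd_index (hLW : thm14_padicValNat_shaOrder_le)
    (hGZK : rank_eq_analyticRank_of_analyticRank_le_one) (hX : ClassX12 W p) (hp7 : 7 ≤ p)
    (hp11 : p ≠ 11) {N : ℕ} [NeZero N] {K' : Type} [Field K'] [NumberField K']
    (hK' : IsImaginaryQuadratic K') (hH : SatisfiesHeegnerHypothesis N K')
    {P : (W.baseChange K').toAffine.Point} (hP : IsHeegnerPoint N W K' P) (hnt : ¬ IsOfFinAddOrder P)
    (hpD : ¬ (p : ℤ) ∣ NumberField.discr K') (hI : ¬ p ∣ (AddSubgroup.zmultiples P).index)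
    {q : ℚ} (hq : shaAn W = (q : ℂ)) (hv : padicValRat p q = 0) : X12.MissingInputAt W p := by
  intro _
  obtain ⟨-, hfin⟩ := hGZK W hX.2.1.le
  haveI : Finite W.sha := hfin
  exact missingPPartAt_of_bsdp W p
    (bsdp_of_lawsonWuthrich_of_not_dvd_index W p hLW hGZK hX hp7 hp11 hK' hH hP hnt hpD hI hq hv)

/-! ## §2 A general T-LW booking shape for ANY class with a one-prime torsion certificate -/

omit [W.IsElliptic] [W.IsGloballyMinimal] hp in
/-- **T-LW with the torsion clause replaced by a ONE-PRIME POINT-COUNT CERTIFICATE** (any class,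
analytic rank `≤ 1`, `p ≥ 7`, `p ≠ 11`): a good odd prime `ℓ` with `p ∤ #Ẽ(𝔽_ℓ)`
(`X12.noPTorsion_isogenyClass_of_not_dvd_reductionPointCount`, part I) discharges `htors`; the rest as
in x1a's `X1.RankOne.Leaf.bsdp_of_lawsonWuthrich_of_not_dvd_index`. For the certificate lane's X1
rank-one leaf pairs this turns the table look-up "no rational `p`-torsion in the isogeny class" into
a kernel-decidable point count. PER PAIR; nothing booked. [cite: LawsonWuthrich2016, §5 Thm. 14 (arXiv:1505.02940 p. 8)]
[cite: SilvermanAEC2009, VII.3.1(b)] [cite: Miller2011LMS, §1 and Def. 1.1] -/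
theorem bsdp_of_lawsonWuthrich_of_pointCount_of_not_dvd_index (W : WeierstrassCurve ℚ)
    [W.IsElliptic] [W.IsGloballyMinimal] (p : ℕ) [Fact p.Prime] (hLW : thm14_padicValNat_shaOrder_le)
    (hGZK : rank_eq_analyticRank_of_analyticRank_le_one) (hr : W.analyticRank ≤ 1) (hp7 : 7 ≤ p)
    (hp11 : p ≠ 11) {ℓ : ℕ} [Fact ℓ.Prime] (hℓ3 : 3 ≤ ℓ) (hgood : W.HasGoodReductionAtPrime ℓ)
    (hN : ¬ p ∣ W.reductionPointCount ℓ)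
    {N : ℕ} [NeZero N] {K' : Type} [Field K'] [NumberField K']
    (hK' : IsImaginaryQuadratic K') (hH : SatisfiesHeegnerHypothesis N K')
    {P : (W.baseChange K').toAffine.Point} (hP : IsHeegnerPoint N W K' P) (hnt : ¬ IsOfFinAddOrder P)
    (hpD : ¬ (p : ℤ) ∣ NumberField.discr K') (hI : ¬ p ∣ (AddSubgroup.zmultiples P).index)
    {q : ℚ} (hq : shaAn W = (q : ℂ)) (hv : padicValRat p q = 0) : BSDp W p :=
  bsdp_of_shaAn_unit_of_noPTorsion W p hGZK hr hq hv
    (noPTorsion_of_padicValNat_shaOrder_eq_zero W p (hGZK W hr).2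
      (LawsonWuthrich2016.padicValNat_shaOrder_eq_zero_of_not_dvd_index hLW W hK' hH hP hnt p hp7
        hp11 hpD (noPTorsion_isogenyClass_of_not_dvd_reductionPointCount W hℓ3 hgood hN) hr hI))

/-! ## §3 `p = 11` included: the same shapes on the GENERAL fact (Theorem 1's item "E is 121c2" is void for CM) -/

/-- **`ord_p #Ш(E/ℚ) = 0` for a CM curve of analytic rank `≤ 1` from the T-LW index certificate at
EVERY `p ≥ 7`, `p = 11` INCLUDED** — on the general fact `thm14_padicValNat_shaOrder_le_general`
(harvest-1 gen 17: Theorem 1's item at `p = 11` as printed, "`E` is the curve 121c2"), whose three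
side conditions are theorems at a CM pair: the torsion clause (`noPTorsion_isogenyClass_of_hasCM`),
the twist clause at `p = 5` (void, `p ≥ 7`) and `j(E) ≠ j(121c2) = −24729001`
(`j_ne_j121c2_of_hasCM`: 121c2 is not CM). [cite: LawsonWuthrich2016, §5 Thm. 14 (arXiv:1505.02940 p. 8); Thm. 1 (p. 2); Lemma 12 (p. 6)]
[cite: Miller2011LMS, §4 (y_K, I_K)] -/
theorem padicValNat_shaOrder_eq_zero_of_lawsonWuthrichGeneral_of_hasCM
    (hLW : thm14_padicValNat_shaOrder_le_general) (hCM : W.HasCM) (hr : W.analyticRank ≤ 1)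
    (hp7 : 7 ≤ p) {N : ℕ} [NeZero N] {K' : Type} [Field K'] [NumberField K']
    (hK' : IsImaginaryQuadratic K') (hH : SatisfiesHeegnerHypothesis N K')
    {P : (W.baseChange K').toAffine.Point} (hP : IsHeegnerPoint N W K' P) (hnt : ¬ IsOfFinAddOrder P)
    (hpD : ¬ (p : ℤ) ∣ NumberField.discr K') (hI : ¬ p ∣ (AddSubgroup.zmultiples P).index) :
    padicValNat p W.shaOrder = 0 :=
  LawsonWuthrich2016.padicValNat_shaOrder_eq_zero_of_not_dvd_index_of_j_ne hLW W hK' hH hP hnt p hp7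
    hpD (noPTorsion_isogenyClass_of_hasCM W hCM (by omega)) (fun _ ↦ j_ne_j121c2_of_hasCM W hCM) hr hI

/-- **THE BOOKING SHAPE at every `p ≥ 7`, `p = 11` INCLUDED (T-LW at an X12 pair, general fact).**
Inputs: the PUBLISHED facts `hLW : thm14_padicValNat_shaOrder_le_general` and `hGZK`; `ClassX12 W p`;
`7 ≤ p`; a Heegner field `K′` (Heegner hypothesis for a level `N`, `p ∤ d_{K′}`); a Heegner point of
infinite order with `p ∤ [E(K′) : ℤ y_{K′}]`; `#Ш_an = q` with `ord_p q = 0`. Then `BSD(E, p)`. This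
is the shape of the four ramified census pairs `121b1, 3025a1, 7744a1, 17424bl1 @ 11` (`j = −32768`).
PER PAIR; nothing booked. [cite: LawsonWuthrich2016, §5 Thm. 14 (arXiv:1505.02940 p. 8); Thm. 1 (p. 2)]
[cite: Miller2011LMS, §1 and Def. 1.1] -/
theorem bsdp_of_lawsonWuthrichGeneral_of_not_dvd_index (hLW : thm14_padicValNat_shaOrder_le_general)
    (hGZK : rank_eq_analyticRank_of_analyticRank_le_one) (hX : ClassX12 W p) (hp7 : 7 ≤ p)
    {N : ℕ} [NeZero N] {K' : Type} [Field K'] [NumberField K']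
    (hK' : IsImaginaryQuadratic K') (hH : SatisfiesHeegnerHypothesis N K')
    {P : (W.baseChange K').toAffine.Point} (hP : IsHeegnerPoint N W K' P) (hnt : ¬ IsOfFinAddOrder P)
    (hpD : ¬ (p : ℤ) ∣ NumberField.discr K') (hI : ¬ p ∣ (AddSubgroup.zmultiples P).index)
    {q : ℚ} (hq : shaAn W = (q : ℂ)) (hv : padicValRat p q = 0) : BSDp W p :=
  bsdp_of_shaAn_unit_of_noPTorsion W p hGZK hX.2.1.le hq hv
    (noPTorsion_of_padicValNat_shaOrder_eq_zero W p (hGZK W hX.2.1.le).2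
      (padicValNat_shaOrder_eq_zero_of_lawsonWuthrichGeneral_of_hasCM W p hLW hX.1 hX.2.1.le hp7 hK'
        hH hP hnt hpD hI))

/-- The general booking shape with `p ∤ d_{K′}` DISCHARGED from `p ∣ N` (the level).
[cite: LawsonWuthrich2016, §5 Thm. 14 (arXiv:1505.02940 p. 8)] [cite: GrossLMS1991, §1 (p. 235)] [cite: Miller2011LMS, §1 and Def. 1.1] -/
theorem bsdp_of_lawsonWuthrichGeneral_of_not_dvd_index_of_dvd_level
    (hLW : thm14_padicValNat_shaOrder_le_general)
    (hGZK : rank_eq_analyticRank_of_analyticRank_le_one) (hX : ClassX12 W p) (hp7 : 7 ≤ p)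
    {N : ℕ} [NeZero N] {K' : Type} [Field K'] [NumberField K']
    (hK' : IsImaginaryQuadratic K') (hH : SatisfiesHeegnerHypothesis N K') (hpN : p ∣ N)
    {P : (W.baseChange K').toAffine.Point} (hP : IsHeegnerPoint N W K' P) (hnt : ¬ IsOfFinAddOrder P)
    (hI : ¬ p ∣ (AddSubgroup.zmultiples P).index)
    {q : ℚ} (hq : shaAn W = (q : ℂ)) (hv : padicValRat p q = 0) : BSDp W p :=
  bsdp_of_lawsonWuthrichGeneral_of_not_dvd_index W p hLW hGZK hX hp7 hK' hH hP hnt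
    (Literature.SatisfiesHeegnerHypothesis.not_dvd_discr hK'.1 hH hp.out hpN) hI hq hv

/-- The general shape with the CM / rank hypotheses spelled out instead of `ClassX12`.
[cite: LawsonWuthrich2016, §5 Thm. 14 (arXiv:1505.02940 p. 8)] [cite: Miller2011LMS, §1 and Def. 1.1] -/
theorem bsdp_of_lawsonWuthrichGeneral_of_hasCM_of_not_dvd_index
    (hLW : thm14_padicValNat_shaOrder_le_general)
    (hGZK : rank_eq_analyticRank_of_analyticRank_le_one) (hCM : W.HasCM) (hr : W.analyticRank ≤ 1)
    (hp7 : 7 ≤ p) {N : ℕ} [NeZero N] {K' : Type} [Field K'] [NumberField K']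
    (hK' : IsImaginaryQuadratic K') (hH : SatisfiesHeegnerHypothesis N K')
    {P : (W.baseChange K').toAffine.Point} (hP : IsHeegnerPoint N W K' P) (hnt : ¬ IsOfFinAddOrder P)
    (hpD : ¬ (p : ℤ) ∣ NumberField.discr K') (hI : ¬ p ∣ (AddSubgroup.zmultiples P).index)
    {q : ℚ} (hq : shaAn W = (q : ℂ)) (hv : padicValRat p q = 0) : BSDp W p :=
  bsdp_of_shaAn_unit_of_noPTorsion W p hGZK hr hq hv
    (noPTorsion_of_padicValNat_shaOrder_eq_zero W p (hGZK W hr).2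
      (padicValNat_shaOrder_eq_zero_of_lawsonWuthrichGeneral_of_hasCM W p hLW hCM hr hp7 hK' hH hP
        hnt hpD hI))

/-- … and the typed residue of X12 follows at such a pair (general fact, `p ≥ 7`).
[cite: LawsonWuthrich2016, §5 Thm. 14 (arXiv:1505.02940 p. 8)] [cite: Miller2011LMS, Def. 1.1] -/
theorem missingInputAt_of_lawsonWuthrichGeneral_of_not_dvd_index
    (hLW : thm14_padicValNat_shaOrder_le_general)
    (hGZK : rank_eq_analyticRank_of_analyticRank_le_one) (hX : ClassX12 W p) (hp7 : 7 ≤ p)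
    {N : ℕ} [NeZero N] {K' : Type} [Field K'] [NumberField K']
    (hK' : IsImaginaryQuadratic K') (hH : SatisfiesHeegnerHypothesis N K')
    {P : (W.baseChange K').toAffine.Point} (hP : IsHeegnerPoint N W K' P) (hnt : ¬ IsOfFinAddOrder P)
    (hpD : ¬ (p : ℤ) ∣ NumberField.discr K') (hI : ¬ p ∣ (AddSubgroup.zmultiples P).index)
    {q : ℚ} (hq : shaAn W = (q : ℂ)) (hv : padicValRat p q = 0) : X12.MissingInputAt W p := by
  intro _
  obtain ⟨-, hfin⟩ := hGZK W hX.2.1.le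
  haveI : Finite W.sha := hfin
  exact missingPPartAt_of_bsdp W p
    (bsdp_of_lawsonWuthrichGeneral_of_not_dvd_index W p hLW hGZK hX hp7 hK' hH hP hnt hpD hI hq hv)

/-- **General T-LW with a one-prime torsion certificate and the `j`-clause, any class, `p ≥ 7`
(incl. `11`).** [cite: LawsonWuthrich2016, §5 Thm. 14 (arXiv:1505.02940 p. 8); Thm. 1 (p. 2)]
[cite: SilvermanAEC2009, VII.3.1(b)] [cite: Miller2011LMS, §1 and Def. 1.1] -/
theorem bsdp_of_lawsonWuthrichGeneral_of_pointCount_of_not_dvd_index (W : WeierstrassCurve ℚ)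
    [W.IsElliptic] [W.IsGloballyMinimal] (p : ℕ) [Fact p.Prime]
    (hLW : thm14_padicValNat_shaOrder_le_general)
    (hGZK : rank_eq_analyticRank_of_analyticRank_le_one) (hr : W.analyticRank ≤ 1) (hp7 : 7 ≤ p)
    (hj : p = 11 → W.j ≠ -24729001) {ℓ : ℕ} [Fact ℓ.Prime] (hℓ3 : 3 ≤ ℓ)
    (hgood : W.HasGoodReductionAtPrime ℓ) (hN : ¬ p ∣ W.reductionPointCount ℓ)
    {N : ℕ} [NeZero N] {K' : Type} [Field K'] [NumberField K']
    (hK' : IsImaginaryQuadratic K') (hH : SatisfiesHeegnerHypothesis N K')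
    {P : (W.baseChange K').toAffine.Point} (hP : IsHeegnerPoint N W K' P) (hnt : ¬ IsOfFinAddOrder P)
    (hpD : ¬ (p : ℤ) ∣ NumberField.discr K') (hI : ¬ p ∣ (AddSubgroup.zmultiples P).index)
    {q : ℚ} (hq : shaAn W = (q : ℂ)) (hv : padicValRat p q = 0) : BSDp W p :=
  bsdp_of_shaAn_unit_of_noPTorsion W p hGZK hr hq hv
    (noPTorsion_of_padicValNat_shaOrder_eq_zero W p (hGZK W hr).2
      (LawsonWuthrich2016.padicValNat_shaOrder_eq_zero_of_not_dvd_index_of_j_ne hLW W hK' hH hP hnt p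
        hp7 hpD (noPTorsion_isogenyClass_of_not_dvd_reductionPointCount W hℓ3 hgood hN) hj hr hI))

end Summit.BirchSwinnertonDyer.Rank1Residual.X12

end
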